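import Literature.Combinatorics.Designs.BaseSequences
import Literature.Combinatorics.Designs.TMatrixRows

/-!
# Hadamard 668 census — the Turyn-type / base-sequence / T-sequence family at `v = 167`, typed in the kernel

Framing: lottery ticket; floor = certified bounds/negative ranges.

Cell pub-namedobj (venture DiscreteObjects), target (H): a Hadamard matrix of order `668 = 4·167`.  The family by which
the previous smallest open order fell (`428 = 4·107`, Kharaghani–Tayfeh-Rezaie 2005: Turyn-type sequences `TT(36)` →
base sequences `BS(71, 71, 36, 36)` → T-sequences of length `107` → Goethals–Seidel array) reaches `668` through
`TT(56)` (Best–Đoković–Kharaghani–Ramp 2013, §1: "TT(56) and TT(60) may be used to construct Hadamard matrices of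
orders 668 and 716"), or through base sequences `BS(m, m, n, n)` with `m + n = 167` (e.g. `BS(84, 84, 83, 83)`, an
instance of the Đoković base-sequence conjecture `BS(n+1, n)`, Seberry–Yamada 2020 Conjecture 5.5), or through any
T-sequences of length `167`.  STATUS IN PRINT (the family is "beyond bound" for the census): `TT(n)` are classified for
even `n ≤ 32` and known for all even `n ≤ 38` (BDKR 2013), 'a few up to 40' found since (London 2013, as cited in
arXiv:2009.10919; London–Kotsireas 2025, 'New Turyn-type sequences', not read — acq-10392); `BS(n+1, n)`
are known for `n ≤ 39` and Golay numbers (SY 2020 §5.9); the list of known T-matrix orders in SY 2020 §1.16 reads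
"…, 164, …, 166, 168, …" — `167` is absent.  Nothing here asserts that any of these objects exists.

What this file gives (all by specialising the general theorems of `Literature/Combinatorics/Designs/TSequences.lean`
and `BaseSequences.lean`, our formalisation of SY 2020 Theorem 3.11 / Theorem 5.2 and BDKR 2013 §5):
* `hadamard668_of_tMatrixRows167` — first rows of circulant T-matrices of order `167` (the weakest, periodic
  hypothesis of the family, SY 2020 Def 1.59) ⇒ an explicit Hadamard matrix of order `668`;
* `hadamard668_of_tSeq167` — T-sequences of length `167` ⇒ an explicit Hadamard matrix of order `668`
  (the Cooper–Wallis rows in the Goethals–Seidel array);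
* `hadamard668_of_baseSeq` — base sequences `BS(m, m, n, n)` with `m + n = 167` ⇒ the same; `hadamard668_of_baseSeq_84_83`;
* `hadamard668_of_turynType56` — `TT(56)` ⇒ the same (`56 + 55 + 56 = 167`);
* existence forms with the order computed (`card_index_167 : |Fin 4 × ZMod 167| = 668`).
So a `TT(56)` / `BS(84, 84, 83, 83)` / T-sequence hit anywhere becomes a KERNEL-certified `H(668)` by `decide` on its
defining autocorrelation identities (as done for the `TT(36)` control in `H428FromTurynType36.lean`).
Typed skeleton only; no order excluded, no existence claimed; HITS 0.  No `sorry`, no `native_decide`.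
-/

namespace Summit.Ventures.DiscreteObjects.Hadamard

open Literature.Combinatorics.Designs.GoethalsSeidel (gsMatrix IsHadamardMatrix)
open Literature.Combinatorics.Designs.TSequences
open Literature.Combinatorics.Designs.BaseSequences
open Literature.Combinatorics.Designs.TMatrices

/-- the order: `|Fin 4 × ZMod 167| = 668`. -/
theorem card_index_167 : Fintype.card (Fin 4 × ZMod 167) = 668 := by
  simp [ZMod.card]

/-- **T-matrices of order 167 ⇒ H(668)**: first rows `t : Fin 4 → ZMod 167 → ℤ` of circulant T-matrices (disjoint
`±1` supports covering every position, periodic autocorrelations summing to `0` off the origin — SY 2020 Def 1.59) give,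
through the Cooper–Wallis rows in the Goethals–Seidel array, a Hadamard matrix of order `668` (SY 2020 Theorem 3.11 at
`n = 167`; order `167` is absent from the known T-matrix orders of SY 2020 §1.16). -/
theorem hadamard668_of_tMatrixRows167 (t : Fin 4 → ZMod 167 → ℤ) (ht : IsTMatrixRows 167 t) :
    IsHadamardMatrix (gsMatrix (cwRowZ t 0) (cwRowZ t 1) (cwRowZ t 2) (cwRowZ t 3)) :=
  tmatrixRows_isHadamard ht

/-- **T-sequences of length 167 ⇒ H(668)**: the four Cooper–Wallis combinations of T-sequences of length `167`, read on
`ZMod 167` and plugged into the Goethals–Seidel array, form a Hadamard matrix of order `668`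
(SY 2020 Theorem 3.11 at `n = 167`). -/
theorem hadamard668_of_tSeq167 (t : Fin 4 → ℕ → ℤ) (ht : IsTSeq 167 t) :
    IsHadamardMatrix (gsMatrix (cwSeq 167 t 0) (cwSeq 167 t 1) (cwSeq 167 t 2) (cwSeq 167 t 3)) :=
  tseq_isHadamard ht

/-- **Base sequences BS(m, m, n, n) with m + n = 167 ⇒ H(668)** (through the T-sequences
`((a+b)/2, 0; (a-b)/2, 0; 0, (c+d)/2; 0, (c-d)/2)` of length `167`). -/
theorem hadamard668_of_baseSeq {m n : ℕ} {a b c d : ℕ → ℤ} (h : IsBaseSeq m n a b c d) (hmn : m + n = 167) :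
    IsHadamardMatrix (gsMatrix (cwSeq 167 (bsT m a b c d) 0) (cwSeq 167 (bsT m a b c d) 1)
      (cwSeq 167 (bsT m a b c d) 2) (cwSeq 167 (bsT m a b c d) 3)) :=
  baseSeq_isHadamard h 167 hmn.symm

/-- in particular **BS(84, 84, 83, 83) ⇒ H(668)** (the `n = 83` instance of the base-sequence conjecture
`BS(n+1, n)`, SY 2020 Conjecture 5.5; open). -/
theorem hadamard668_of_baseSeq_84_83 {a b c d : ℕ → ℤ} (h : IsBaseSeq 84 83 a b c d) :
    IsHadamardMatrix (gsMatrix (cwSeq 167 (bsT 84 a b c d) 0) (cwSeq 167 (bsT 84 a b c d) 1)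
      (cwSeq 167 (bsT 84 a b c d) 2) (cwSeq 167 (bsT 84 a b c d) 3)) :=
  hadamard668_of_baseSeq h rfl

/-- **Turyn-type sequences TT(56) ⇒ H(668)**: `TT(56)` ⇒ `BS(111, 111, 56, 56)` ⇒ T-sequences of length
`111 + 56 = 167` ⇒ a Hadamard matrix of order `668` (BDKR 2013 §1; SY 2020 Theorem 5.2 with `m = 56`, `n = 55`). -/
theorem hadamard668_of_turynType56 {x y z w : ℕ → ℤ} (h : IsTurynType 56 x y z w) :
    IsHadamardMatrix (gsMatrix (cwSeq 167 (ttT 56 x y z w) 0) (cwSeq 167 (ttT 56 x y z w) 1)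
      (cwSeq 167 (ttT 56 x y z w) 2) (cwSeq 167 (ttT 56 x y z w) 3)) :=
  turynType_isHadamard h 167 (by norm_num)

/-- existence form: **if TT(56) exist, a Hadamard matrix of order 668 exists** (typed reduction; `TT(56)` is open). -/
theorem exists_hadamard668_of_turynType56 (h : ∃ x y z w : ℕ → ℤ, IsTurynType 56 x y z w) :
    ∃ H : Matrix (Fin 4 × ZMod 167) (Fin 4 × ZMod 167) ℤ, IsHadamardMatrix H ∧ Fintype.card (Fin 4 × ZMod 167) = 668 := by
  obtain ⟨x, y, z, w, h⟩ := h
  exact ⟨_, hadamard668_of_turynType56 h, card_index_167⟩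

/-- existence form: **if base sequences BS(m, m, n, n) with m + n = 167 exist, a Hadamard matrix of order 668 exists**
(in particular from `BS(84, 84, 83, 83)`; open). -/
theorem exists_hadamard668_of_baseSeq
    (h : ∃ (m n : ℕ) (a b c d : ℕ → ℤ), IsBaseSeq m n a b c d ∧ m + n = 167) :
    ∃ H : Matrix (Fin 4 × ZMod 167) (Fin 4 × ZMod 167) ℤ, IsHadamardMatrix H ∧ Fintype.card (Fin 4 × ZMod 167) = 668 := by
  obtain ⟨m, n, a, b, c, d, h, hmn⟩ := h
  exact ⟨_, hadamard668_of_baseSeq h hmn, card_index_167⟩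

/-- existence form: **if circulant T-matrices of order 167 exist, a Hadamard matrix of order 668 exists** (open). -/
theorem exists_hadamard668_of_tMatrixRows167 (h : ∃ t : Fin 4 → ZMod 167 → ℤ, IsTMatrixRows 167 t) :
    ∃ H : Matrix (Fin 4 × ZMod 167) (Fin 4 × ZMod 167) ℤ, IsHadamardMatrix H ∧ Fintype.card (Fin 4 × ZMod 167) = 668 := by
  obtain ⟨t, ht⟩ := h
  exact ⟨_, hadamard668_of_tMatrixRows167 t ht, card_index_167⟩

/-- existence form: **if T-sequences of length 167 exist, a Hadamard matrix of order 668 exists** (T-matrices of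
order `167` are not in the known list of SY 2020 §1.16; open). -/
theorem exists_hadamard668_of_tSeq167 (h : ∃ t : Fin 4 → ℕ → ℤ, IsTSeq 167 t) :
    ∃ H : Matrix (Fin 4 × ZMod 167) (Fin 4 × ZMod 167) ℤ, IsHadamardMatrix H ∧ Fintype.card (Fin 4 × ZMod 167) = 668 := by
  obtain ⟨t, ht⟩ := h
  exact ⟨_, hadamard668_of_tSeq167 t ht, card_index_167⟩

end Summit.Ventures.DiscreteObjects.Hadamard
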